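import Literature.AlgebraicGeometry.Frobenioids.EquivalenceBaseIdentitySlim
import Literature.AlgebraicGeometry.Frobenioids.BiratPreservesUnits
import HarnessLib

/-!
# Frobenioids I, Cor. 4.11 (ii): over a DIV-SLIM base an equivalence preserves the base-identity
# ENDOMORPHISMS whose transports act trivially on the divisor monoid

Mochizuki, *The geometry of Frobenioids I: the general theory*, Kyushu J. Math. **62** (2008)
293–400, proof of Cor. 4.11 (ii), kurims text p. 93 ll. 36–46 [cite: MochizukiFrdI2008, Cor. 4.11 (ii) p.93]:

> "Thus, since `D_i` is Div-slim, the base-identity endomorphisms of `A ∈ Ob(C_i^birat)` may be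
> characterized as the endomorphisms of `A` that arise from endomorphisms
> `φ ∈ End((C_i^birat)^pl-bk_A → C_i^birat)` such that every endomorphism [of an object of `C_i^birat`]
> induced by `φ` projects to an automorphism of `D_i` that is mapped by `Φ_i` to an identity
> automorphism. … we thus conclude that `Ψ^birat` preserves the base-identity endomorphisms [hence, in
> particular, that `Ψ^birat` preserves "`O^×(−)`"]."

PROOF-ONLY file (seat abc-iut-L1-d6, cell sub-DAG S2 = `plan/L1/SUBDAG-FrdI-Cor411.md`, the apex of
row L11 in its printed generality: ENDOMORPHISMS, not only units). This is the Div-slim analogue of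
`EquivalenceBaseIdentitySlim.lean` (seat abc-iut-w4-d109, Thm. 3.4 (v) over SLIM bases) and the
endomorphism analogue of `BiratPreservesUnits.mapIso_mem_unitsSubgroup_of_pull_eq` (seat abc-iut-L1-d4,
units): for pre-Frobenioids `G_i : C_i → F_{Θ_i}` over `D_i` (in the application: the birationalizations
`C_i^birat → F_{0_{D_i}}`), a SECOND contravariant monoid `Φ₂` on `D₂` through which Div-slimness is
measured (in the application: the divisor monoid of the ORIGINAL Frobenioid `C₂`), and an equivalence
`Ψ : C₁ ⥲ C₂` (in the application: `Ψ^birat`):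

* `PreFrobenioid.isBaseIdentity_app_of_isDivSlim` — over a base `D` that is Div-slim relative to `Φ'`,
  every element of `End((C^pl-bk)_A → C)^bs-iso` ALL OF WHOSE COMPONENTS PROJECT TO `Φ'`-IDENTITY
  automorphisms of `D` has base-identity components (its shadow on `D_{A_D} → D` through the equivalence
  `(C^pl-bk)_A ⥲ D_{A_D}` of Def. 1.3 (i)(c) — a hypothesis `hic` — is an automorphism acting trivially on
  `Φ'`, hence trivial by Div-slimness);
* `PreFrobenioid.isBaseIdentity_map_of_isDivSlim` — hence an equivalence `Ψ` which carries
  base-isomorphisms to base-isomorphisms, whose quasi-inverse carries pull-back morphisms to pull-back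
  morphisms, and which carries base-identity endomorphisms of `C₁` to endomorphisms of `C₂` projecting to
  `Φ₂`-identity endomorphisms of `D₂` (the printed input "[cf. Theorem 4.2, (ii); … perf-factorial and
  non-dilating]", a hypothesis `hdi` here), carries base-identity endomorphisms to BASE-IDENTITY
  endomorphisms whenever `D₂` is Div-slim relative to `Φ₂` — extend (abc-iut-w4-d109's
  `exists_endPlbkBsIso_of_isBaseIdentity`), transport (`exists_transport_endPlbkBsIso_hom`), read off
  the component at the identity;
* `PreFrobenioid.mapIso_mem_unitsSubgroup_of_isDivSlim'` — in particular `Ψ` carries `O^×(−)` to `O^×(−)`.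

No statement of the paper is restated or strengthened; no new definitions; nothing here is specific to
the abc programme.
-/

namespace Literature.AlgebraicGeometry.Frobenioids

open CategoryTheory Opposite

universe w w' v v' u u' v₁ u₁

namespace PreFrobenioid

open PreFrobenioidData (ofFunctor)

/-! ### Over a Div-slim base, `Φ'`-trivial compatible families have base-identity components -/

section OneDivSlim

variable {D : Type u} [Category.{v} D] {Θ : Dᵒᵖ ⥤ CommMonCat.{w}} {Φ' : Dᵒᵖ ⥤ CommMonCat.{w'}}
  {C : Type u'} [Category.{v'} C] {G : C ⥤ ElemFrobenioid Θ}

/-- **Div-slimness kills the base of every `Φ'`-trivial compatible family** (FrdI proof of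
Cor. 4.11 (ii), p. 93 ll. 36–42, the Div-slim form of the `P_i`-argument of Thm. 3.4 (v) p. 67): for a
pre-Frobenioid `G : C → F_Θ` over `D` satisfying Def. 1.3 (i)(c) (`hic`: `(C^pl-bk)_B ⥲ D_{B_D}`) with `D`
Div-slim relative to a monoid `Φ'` on `D` (`hds`), every element `N` of `End((C^pl-bk)_A → C)^bs-iso` whose
components all project to `Φ'`-identity automorphisms of `D` has base-identity components.
[cite: MochizukiFrdI2008, Cor. 4.11 (ii) p.93] -/
theorem isBaseIdentity_app_of_isDivSlim
    (hic : ∀ B : C, (pullbackSliceToBase G B).IsEquivalence)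
    (hds : ∀ (X : D) (α : Aut (Over.forget X)),
      (∀ (V : Over X) (x : Φ'.obj (op V.left)), pull Φ' (α.hom.app V) x = x) → α = 1)
    (A : C) (N : (ofFunctor Θ G).EndPlbkBsIso A)
    (hN : ∀ ⦃B : C⦄ (φ : B ⟶ A) (hφ : (ofFunctor Θ G).IsPullbackMorphism φ),
      pull Φ' (Base G (N.app φ hφ)) = MonoidHom.id _)
    ⦃B : C⦄ (φ : B ⟶ A) (hφ : (ofFunctor Θ G).IsPullbackMorphism φ) :
    IsBaseIdentity G (N.app φ hφ) := by
  classical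
  -- Def. 1.3 (i)(c): the equivalence `E : C^pl-bk_A ⥲ D_{A_D}` and the forgetful `U : D_{A_D} → D`
  let A' : PullbackCat G := ⟨A⟩
  let E := pullbackSliceToBase G A
  haveI : E.IsEquivalence := hic A
  let X₀ : D := (wideSubcategoryInclusion (pullbackMorphisms G) ⋙ baseFunctor G).obj A'
  let U : Over X₀ ⥤ D := Over.forget X₀
  have hpb : ∀ p : Over A', (ofFunctor Θ G).IsPullbackMorphism p.hom.hom := fun p =>
    (PreFrobenioidData.ofFunctor_isPullbackMorphism G _).mpr p.hom.property
  -- the shadow of `N` on `E ⋙ U`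
  let θ : End (E ⋙ U) :=
    { app := fun p => Base G (N.app p.hom.hom (hpb p))
      naturality := by
        intro p p' f
        have hg : f.left.hom ≫ p'.hom.hom = p.hom.hom := congrArg (fun k => k.hom) (Over.w f)
        have := N.naturality p'.hom.hom (hpb p') p.hom.hom (hpb p) f.left.hom hg
        change Base G f.left.hom ≫ Base G (N.app p'.hom.hom (hpb p')) =
          Base G (N.app p.hom.hom (hpb p)) ≫ Base G f.left.hom
        rw [← base_comp, ← base_comp, this] }
  have hθapp : ∀ p : Over A', θ.app p = Base G (N.app p.hom.hom (hpb p)) := fun _ => rfl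
  have hunit : IsUnit θ := by
    rw [isUnit_iff_isIso]
    haveI : ∀ p : Over A', IsIso (θ.app p) := fun p => N.isBaseIso p.hom.hom (hpb p)
    exact NatIso.isIso_of_isIso_app _
  -- transport to `Aut(D_{A_D} → D)` along `(End _)ˣ ≃ Aut (E ⋙ U) ≃ Aut U` (whiskering by `E`)
  have hW : ((Functor.whiskeringLeft (Over A') (Over X₀) D).obj E).FullyFaithful :=
    Functor.FullyFaithful.ofFullyFaithful _
  let e₁ : (End (E ⋙ U))ˣ ≃* Aut (E ⋙ U) := Aut.unitsEndEquivAut (E ⋙ U)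
  let e₂ : Aut U ≃* Aut (E ⋙ U) := hW.autMulEquivOfFullyFaithful U
  let a : Aut U := e₂.symm (e₁ hunit.unit)
  -- the components of `a` on the image of `E` are those of `θ`
  have ha_E : ∀ p : Over A', a.hom.app (E.obj p) = θ.app p := by
    intro p
    have h1 : e₂ a = e₁ hunit.unit := e₂.apply_symm_apply _
    have h2 : (e₂ a).hom.app p = a.hom.app (E.obj p) := rfl
    have h3 : (e₁ hunit.unit).hom = θ := by
      change (hunit.unit : End (E ⋙ U)) = θ
      exact IsUnit.unit_spec hunit
    rw [← h2, h1, h3]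
  -- every component of `a` acts trivially on `Φ'` (transport along `E p ≅ V`, `E` essentially surjective)
  have ha : ∀ (V : Over X₀) (x : Φ'.obj (op V.left)), pull Φ' (a.hom.app V) x = x := by
    intro V x
    let p : Over A' := E.objPreimage V
    let i : E.obj p ≅ V := E.objObjPreimageIso V
    have hnat : U.map i.hom ≫ a.hom.app V = a.hom.app (E.obj p) ≫ U.map i.hom := a.hom.naturality i.hom
    have hV : a.hom.app V = U.map i.inv ≫ a.hom.app (E.obj p) ≫ U.map i.hom := by
      rw [← hnat, ← Category.assoc, ← U.map_comp, i.inv_hom_id, U.map_id, Category.id_comp]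
    rw [hV, ha_E p, hθapp p, pull_comp, pull_comp]
    have htriv : pull Φ' (Base G (N.app p.hom.hom (hpb p))) (pull Φ' (U.map i.hom) x) =
        pull Φ' (U.map i.hom) x := by
      rw [hN p.hom.hom (hpb p), MonoidHom.id_apply]
    calc pull Φ' (U.map i.inv) (pull Φ' (Base G (N.app p.hom.hom (hpb p))) (pull Φ' (U.map i.hom) x))
        = pull Φ' (U.map i.inv) (pull Φ' (U.map i.hom) x) := congrArg (pull Φ' (U.map i.inv)) htriv
      _ = x := by rw [← pull_comp, ← U.map_comp, i.inv_hom_id, U.map_id, pull_id]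
  have hone : a = 1 := hds X₀ a ha
  have hθ : θ = 1 := by
    have h1 : hunit.unit = 1 := by
      have hinj : Function.Injective (fun u : (End (E ⋙ U))ˣ => e₂.symm (e₁ u)) :=
        e₂.symm.injective.comp e₁.injective
      apply hinj
      change a = e₂.symm (e₁ 1)
      rw [map_one, map_one]
      exact hone
    have := congrArg Units.val h1
    rwa [IsUnit.unit_spec, Units.val_one] at this
  -- read off the component at `(B, φ)`
  have hφ' : pullbackMorphisms G φ := (PreFrobenioidData.ofFunctor_isPullbackMorphism G φ).mp hφ
  let p₀ : Over A' := Over.mk (⟨φ, hφ'⟩ : (⟨B⟩ : PullbackCat G) ⟶ A')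
  have key := congrArg (fun t : End (E ⋙ U) => t.app p₀) hθ
  exact key

end OneDivSlim

/-! ### `Ψ` preserves base-identity endomorphisms over a Div-slim `D₂` -/

section Two

variable {D₁ : Type u} [Category.{v} D₁] {Θ₁ : D₁ᵒᵖ ⥤ CommMonCat.{w}}
  {C₁ : Type u'} [Category.{v'} C₁] {G₁ : C₁ ⥤ ElemFrobenioid Θ₁}
  {D₂ : Type u} [Category.{v} D₂] {Θ₂ : D₂ᵒᵖ ⥤ CommMonCat.{w}} {Φ₂ : D₂ᵒᵖ ⥤ CommMonCat.{w'}}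
  {C₂ : Type u'} [Category.{v'} C₂] {G₂ : C₂ ⥤ ElemFrobenioid Θ₂}

/-- **[FrdI] Cor. 4.11 (ii), p. 93 ll. 36–46: an equivalence preserves base-identity ENDOMORPHISMS over a
Div-slim base, given that it carries them to `Φ₂`-identity endomorphisms.** Let `G_i : C_i → F_{Θ_i}` be
pre-Frobenioids over `D_i`, `G₂` satisfying Def. 1.3 (i)(c) (`hic₂`), `D₂` Div-slim relative to a monoid `Φ₂`
on `D₂` (`hds₂`), and `Ψ : C₁ ⥲ C₂` an equivalence carrying base-isomorphisms to base-isomorphisms (`hbi`),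
whose quasi-inverse carries pull-back morphisms to pull-back morphisms (`hpb'`), and which carries every
base-identity endomorphism of `C₁` to an endomorphism of `C₂` projecting to a `Φ₂`-identity endomorphism
of `D₂` (`hdi` — print: "[cf. Theorem 4.2, (ii); … the `Φ_i` are perf-factorial and non-dilating]"). Then
`Ψ` carries base-identity endomorphisms (of any Frobenius degree) to base-identity endomorphisms: extend
`δ` (conjugated to `Ψ⁻¹Ψ A`) to `End((C₁^pl-bk)_{Ψ⁻¹Ψ A} → C₁)^bs-iso` with base-identity components,
transport along `Ψ`, and read off the component at `id_{Ψ A}`, whose base is trivial by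
`isBaseIdentity_app_of_isDivSlim`. [cite: MochizukiFrdI2008, Cor. 4.11 (ii) p.93] -/
theorem isBaseIdentity_map_of_isDivSlim
    (hic₂ : ∀ B : C₂, (pullbackSliceToBase G₂ B).IsEquivalence)
    (hds₂ : ∀ (X : D₂) (α : Aut (Over.forget X)),
      (∀ (V : Over X) (x : Φ₂.obj (op V.left)), pull Φ₂ (α.hom.app V) x = x) → α = 1)
    (Ψ : C₁ ≌ C₂)
    (hbi : ∀ ⦃X Y : C₁⦄ (f : X ⟶ Y), IsBaseIso G₁ f → IsBaseIso G₂ (Ψ.functor.map f))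
    (hpb' : ∀ ⦃Y Z : C₂⦄ (δ : Y ⟶ Z), IsPullbackMorphism G₂ δ → IsPullbackMorphism G₁ (Ψ.inverse.map δ))
    (hdi : ∀ (A : C₁) (φ : A ⟶ A), IsBaseIdentity G₁ φ →
      pull Φ₂ (Base G₂ (Ψ.functor.map φ)) = MonoidHom.id _)
    {A : C₁} {δ : A ⟶ A} (hδ : IsBaseIdentity G₁ δ) : IsBaseIdentity G₂ (Ψ.functor.map δ) := by
  have hpbS : ∀ ⦃Y Z : C₂⦄ (χ : Y ⟶ Z), (ofFunctor Θ₂ G₂).IsPullbackMorphism χ →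
      (ofFunctor Θ₁ G₁).IsPullbackMorphism (Ψ.inverse.map χ) := fun Y Z χ hχ =>
    (PreFrobenioidData.ofFunctor_isPullbackMorphism G₁ _).mpr
      (hpb' χ ((PreFrobenioidData.ofFunctor_isPullbackMorphism G₂ χ).mp hχ))
  have hbiS : ∀ ⦃X Y : C₁⦄ (f : X ⟶ Y), (ofFunctor Θ₁ G₁).IsBaseIso f →
      (ofFunctor Θ₂ G₂).IsBaseIso (Ψ.functor.map f) := hbi
  -- conjugate `δ` to `Ψ⁻¹Ψ A` and extend it over the pull-back morphisms (base-identity components)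
  let u : A ≅ Ψ.inverse.obj (Ψ.functor.obj A) := Ψ.unitIso.app A
  have hδ' : IsBaseIdentity G₁ (u.inv ≫ δ ≫ u.hom) := hδ.conj_iso u
  obtain ⟨N, hNb, hN⟩ := (ofFunctor Θ₁ G₁).exists_endPlbkBsIso_of_isBaseIdentity (u.inv ≫ δ ≫ u.hom) hδ'
  -- transport along `Ψ`
  obtain ⟨T, hT⟩ := PreFrobenioidData.exists_transport_endPlbkBsIso_hom (ofFunctor Θ₁ G₁)
    (ofFunctor Θ₂ G₂) Ψ hpbS hbiS (Ψ.functor.obj A)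
  -- every component of `T N` projects to a `Φ₂`-identity automorphism (`hdi` + conjugation by the counit)
  have hTN : ∀ ⦃Y : C₂⦄ (χ : Y ⟶ Ψ.functor.obj A) (hχ : (ofFunctor Θ₂ G₂).IsPullbackMorphism χ),
      pull Φ₂ (Base G₂ ((T N).app χ hχ)) = MonoidHom.id _ := by
    intro Y χ hχ
    obtain ⟨e, -, he⟩ := hT N χ hχ
    rw [he]
    exact pull_base_conj_iso (hdi _ _ (hNb (Ψ.inverse.map χ) (hpbS χ hχ)).2) e
  have h1 : IsBaseIdentity G₂ ((T N).app (𝟙 _) ((ofFunctor Θ₂ G₂).isPullbackMorphism_id _)) :=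
    isBaseIdentity_app_of_isDivSlim hic₂ hds₂ _ (T N) hTN (𝟙 _) _
  obtain ⟨e, -, he⟩ := hT N (𝟙 _) ((ofFunctor Θ₂ G₂).isPullbackMorphism_id _)
  rw [he, PreFrobenioidData.EndPlbkBsIso.app_congr_of_eq (ofFunctor Θ₁ G₁) N (Ψ.inverse.map_id _)
    (hpbS _ ((ofFunctor Θ₂ G₂).isPullbackMorphism_id _)) ((ofFunctor Θ₁ G₁).isPullbackMorphism_id _),
    hN] at h1
  -- `h1 : Base(e⁻¹ ≫ Ψ(u⁻¹ ≫ δ ≫ u) ≫ e) = id`; conjugate back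
  have h2 := h1.conj_iso (e.symm ≪≫ (Ψ.functor.mapIso u).symm)
  have h3 : (e.symm ≪≫ (Ψ.functor.mapIso u).symm).inv ≫
      (e.inv ≫ Ψ.functor.map (u.inv ≫ δ ≫ u.hom) ≫ e.hom) ≫ (e.symm ≪≫ (Ψ.functor.mapIso u).symm).hom =
        Ψ.functor.map δ := by
    simp
  rw [h3] at h2
  exact h2

/-- **In particular `Ψ` carries `O^×(−)` to `O^×(−)`** (p. 93 l. 46: "hence, in particular, that
`Ψ^birat` preserves '`O^×(−)`'"): a unit (base-identity linear automorphism) is carried to a base-identity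
automorphism, which is linear (`deg_Fr` of an isomorphism is `1`).
[cite: MochizukiFrdI2008, Cor. 4.11 (ii) p.93] -/
theorem mapIso_mem_unitsSubgroup_of_isDivSlim'
    (hic₂ : ∀ B : C₂, (pullbackSliceToBase G₂ B).IsEquivalence)
    (hds₂ : ∀ (X : D₂) (α : Aut (Over.forget X)),
      (∀ (V : Over X) (x : Φ₂.obj (op V.left)), pull Φ₂ (α.hom.app V) x = x) → α = 1)
    (Ψ : C₁ ≌ C₂)
    (hbi : ∀ ⦃X Y : C₁⦄ (f : X ⟶ Y), IsBaseIso G₁ f → IsBaseIso G₂ (Ψ.functor.map f))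
    (hpb' : ∀ ⦃Y Z : C₂⦄ (δ : Y ⟶ Z), IsPullbackMorphism G₂ δ → IsPullbackMorphism G₁ (Ψ.inverse.map δ))
    (hdi : ∀ (A : C₁) (φ : A ⟶ A), IsBaseIdentity G₁ φ →
      pull Φ₂ (Base G₂ (Ψ.functor.map φ)) = MonoidHom.id _)
    {A : C₁} (f : Aut A) (hf : f ∈ unitsSubgroup G₁ A) :
    Ψ.functor.mapIso f ∈ unitsSubgroup G₂ (Ψ.functor.obj A) := by
  have hfb : IsBaseIdentity G₁ f.hom := (show IsBaseIdentity G₁ f.hom ∧ IsLinear G₁ f.hom from hf).1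
  exact ⟨isBaseIdentity_map_of_isDivSlim hic₂ hds₂ Ψ hbi hpb' hdi hfb, degFr_iso_hom G₂ (Ψ.functor.mapIso f)⟩

end Two

end PreFrobenioid

end Literature.AlgebraicGeometry.Frobenioids
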